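import Literature.AnabelianGeometry.AbsoluteAnabelian.AbsTopIII.BirationalReconstruction
import Literature.AnabelianGeometry.AbsoluteAnabelian.AbsTopIII.FunctionFieldConstantDivisibilityProofs
import HarnessLib

/-!
# [AbsTopIII] Theorem 1.11, slimness of `Δ_{η_X}` — for every base field of characteristic zero

S. Mochizuki, *Topics in absolute anabelian geometry III*, Theorem 1.11 (pp. 45–47), asserts for a
function field `K = K_X` of one variable over a Kummer-faithful field `k` that `Δ_{η_X}`,
`Π_{η_X} = Gal(K̄/K)` and `G_k` are slim; the cell file `BirationalReconstruction.lean` records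
this as the three-conjunct closed fact `AbsTopIII.Thm_1_11_slim`, in which
`Δ_{η_X} = Ker(Gal(K̄/K) → Gal(k̄/k))` is `(genericPointExtension k K hsurj).geom`.

This proof-only file proves the `Δ_{η_X}` conjunct UNCONDITIONALLY, for EVERY base field `k` of
characteristic zero (no Kummer-faithfulness is needed; the printed proof, p. 47, refers to the
argument of [AbsTopII] Cor. 2.10).  The route is elementary:

1. (Kummer) if `σ ∈ Δ` centralises `Δ ∩ Gal(K̄/M)` for a finite extension `M/K`, then for every
   `x ∈ K̄^×` and `n ≥ 1` the element `σ(x)/x` is an `n`-th power in the compositum `M · k̃` of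
   `M` with the field `k̃ ⊆ K̄` of elements algebraic over `k` (`σ` fixes all roots of unity,
   these being algebraic over `k`), hence in `M'·N` for a finite extension `M' ⊇ M` of `K`
   containing `σ(x)/x` and some finite `N/k`;
2. (constant field extensions are unramified, file `FunctionFieldConstantDivisibilityProofs`,
   Stichtenoth Thm. 3.6.3 (a)) hence `σ(x)/x` is algebraic over `k`;
3. (additivity) `σ(1 + x) = 1 + σ(x)` with `σ(y) = c_y · y`, `c_y ∈ k̃`, forces `c_x = 1` for `x`
   transcendental over `k`, while `σ` fixes `k̃` by definition of `Δ`; so `σ = 1`.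

Results: `isSlimGroup_ker_absGaloisRestrict` / `isSlimGroup_geom_genericPointExtension`
(= conjunct (b) of `Thm_1_11_slim`, for all `k` of characteristic zero) and the reduction
`Thm_1_11_slim_of_generic_of_base` of the fact to its conjuncts (a) and (c).

HONEST FRAMING: classical statements about Galois groups of function fields; nothing here bears on
[IUTchIII] Cor. 3.12. [cite: MochizukiAbsTopIII2015, Thm 1.11 pp.45–47]
-/

noncomputable section

open scoped Classical Polynomial IntermediateField

namespace Literature.AnabelianGeometry.AbsoluteAnabelian.AbsTopIII

open Field Polynomial
open Literature.NumberTheory.GaloisRepresentations (absGaloisRestrict absClosureEmbedding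
  absGaloisRestrict_apply_smul)
open Literature.NumberTheory.DiophantineGeometry
open Literature.NumberTheory.DiophantineGeometry.AlgFunctionField
open Literature.AlgebraicGeometry.Frobenioids (IsSlimGroup)

universe u

/-! ### `Δ = Ker(Gal(K̄/K) → Gal(k̄/k))` and the elements of `K̄` algebraic over `k` -/

section Delta

variable (k K : Type u) [Field k] [Field K] [Algebra k K]

/-- Every element of `K̄` algebraic over `k` is in the image of the chosen embedding `k̄ → K̄`
(the roots of its minimal polynomial in `K̄` are the images of its roots in `k̄`). [folklore] -/
private theorem exists_absClosureEmbedding_eq_of_isAlgebraic {y : AlgebraicClosure K}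
    (hy : IsAlgebraic k y) : ∃ z : AlgebraicClosure k, absClosureEmbedding k K z = y := by
  have hint : IsIntegral k y := hy.isIntegral
  set p : k[X] := minpoly k y with hp
  have hp0 : p ≠ 0 := minpoly.ne_zero hint
  set p₁ : (AlgebraicClosure k)[X] := p.map (algebraMap k (AlgebraicClosure k)) with hp₁
  have hcard : p₁.roots.card = p₁.natDegree := splits_iff_card_roots.mp (IsAlgClosed.splits p₁)
  have hroots := roots_map_of_injective_of_card_eq_natDegree
    (f := (absClosureEmbedding k K : AlgebraicClosure k →+* AlgebraicClosure K))
    (absClosureEmbedding k K).toRingHom.injective hcard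
  have hmap : p₁.map (absClosureEmbedding k K : AlgebraicClosure k →+* AlgebraicClosure K) =
      p.map (algebraMap k (AlgebraicClosure K)) := by
    rw [hp₁, Polynomial.map_map]
    congr 1
    exact (absClosureEmbedding k K).comp_algebraMap
  have hy' : y ∈ (p.map (algebraMap k (AlgebraicClosure K))).roots := by
    rw [mem_roots_map_of_injective (algebraMap k (AlgebraicClosure K)).injective hp0, ← aeval_def,
      hp, minpoly.aeval]
  rw [← hmap, ← hroots, Multiset.mem_map] at hy'
  obtain ⟨z, -, hz⟩ := hy'
  exact ⟨z, hz⟩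

/-- An element of `Δ = Ker(Gal(K̄/K) → Gal(k̄/k))` fixes every element of `K̄` algebraic over `k`.
[cite: MochizukiAbsTopIII2015, Thm 1.11 p.45] -/
theorem smul_eq_of_absGaloisRestrict_eq_one (σ : absoluteGaloisGroup K)
    (hσ : absGaloisRestrict k K σ = 1) {y : AlgebraicClosure K} (hy : IsAlgebraic k y) :
    σ • y = y := by
  obtain ⟨z, rfl⟩ := exists_absClosureEmbedding_eq_of_isAlgebraic k K hy
  have h := absGaloisRestrict_apply_smul k K σ z
  rw [hσ, one_smul] at h
  exact h.symm

/-- Conversely, an element of `Gal(K̄/K)` fixing every element algebraic over `k` lies in `Δ`.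
[cite: MochizukiAbsTopIII2015, Thm 1.11 p.45] -/
theorem absGaloisRestrict_eq_one_of_forall_smul_eq (τ : absoluteGaloisGroup K)
    (h : ∀ y : AlgebraicClosure K, IsAlgebraic k y → τ • y = y) :
    absGaloisRestrict k K τ = 1 := by
  haveI : Algebra.IsAlgebraic k (AlgebraicClosure k) := AlgebraicClosure.isAlgebraic k
  apply (absoluteGaloisGroup.toAlgEquiv k).injective
  rw [map_one]
  refine AlgEquiv.ext fun z => ?_
  rw [AlgEquiv.one_apply]
  change absGaloisRestrict k K τ • z = z
  apply (absClosureEmbedding k K).toRingHom.injective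
  change absClosureEmbedding k K (absGaloisRestrict k K τ • z) = absClosureEmbedding k K z
  rw [absGaloisRestrict_apply_smul]
  exact h _ ((Algebra.IsAlgebraic.isAlgebraic (R := k) z).algHom (absClosureEmbedding k K))

end Delta

/-! ### Theorem 1.11: `Δ_{η_X}` is slim -/

/-- **Slimness of `Ker(Gal(K̄/K) → Gal(k̄/k))` for a function field of one variable `K/k`,
`char k = 0`** (the group `Δ_{η_X}` of [AbsTopIII] Thm. 1.11, as a subgroup of Mathlib's
`Field.absoluteGaloisGroup K`): every element of the kernel centralising an open subgroup of the
kernel is trivial.  Proof: module docstring, steps 1–3.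
[cite: MochizukiAbsTopIII2015, Thm 1.11 pp.45–47] -/
theorem isSlimGroup_ker_absGaloisRestrict (k K : Type u) [Field k] [CharZero k] [Field K]
    [CharZero K] [Algebra k K] [IsAlgFunctionField k K] :
    IsSlimGroup (absGaloisRestrict k K).toMonoidHom.ker := by
  haveI : Algebra.IsAlgebraic K (AlgebraicClosure K) := AlgebraicClosure.isAlgebraic K
  refine ⟨fun U hU => ?_⟩
  rw [eq_bot_iff]
  intro σ hσ
  rw [Subgroup.mem_centralizer_iff] at hσ
  rw [Subgroup.mem_bot]
  have hσΔ : absGaloisRestrict k K (σ : absoluteGaloisGroup K) = 1 := MonoidHom.mem_ker.mp σ.2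
  -- the underlying field automorphism
  set σ' : AlgebraicClosure K ≃ₐ[K] AlgebraicClosure K :=
    absoluteGaloisGroup.toAlgEquiv K (σ : absoluteGaloisGroup K) with hσ'
  suffices hfix : ∀ x : AlgebraicClosure K, σ' x = x by
    apply Subtype.ext
    apply (absoluteGaloisGroup.toAlgEquiv K).injective
    rw [Subgroup.coe_one, map_one]
    exact AlgEquiv.ext hfix
  -- `σ'` fixes every element algebraic over `k`
  have hσalg : ∀ y : AlgebraicClosure K, IsAlgebraic k y → σ' y = y := fun y hy =>
    smul_eq_of_absGaloisRestrict_eq_one k K _ hσΔ hy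
  -- an open subgroup of `Δ` contains `Δ ∩ Gal(K̄/E₀)` for a finite subextension `E₀/K`
  obtain ⟨V, hVopen, hVU⟩ := isOpen_induced_iff.mp hU
  have hV1 : V ∈ nhds (1 : absoluteGaloisGroup K) := by
    refine hVopen.mem_nhds ?_
    have h1 : ((1 : (absGaloisRestrict k K).toMonoidHom.ker) : absoluteGaloisGroup K) ∈ V := by
      change (1 : (absGaloisRestrict k K).toMonoidHom.ker) ∈ Subtype.val ⁻¹' V
      rw [hVU]
      exact U.one_mem
    exact h1
  obtain ⟨E₀, hE₀fin, hE₀V⟩ := (krullTopology_mem_nhds_one_iff K (AlgebraicClosure K) V).mp hV1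
  haveI := hE₀fin
  -- `σ'` commutes with every `τ ∈ Gal(K̄/L)`, `L ⊇ E₀` containing all `k`-algebraic elements
  have hcomm : ∀ L : IntermediateField K (AlgebraicClosure K), E₀ ≤ L →
      ((algebraicClosure k (AlgebraicClosure K) : Set (AlgebraicClosure K)) ⊆ L) →
      ∀ τ ∈ L.fixingSubgroup, ∀ y : AlgebraicClosure K, τ (σ' y) = σ' (τ y) := by
    intro L hE₀L hAL τ hτ y
    have hτΔ : absGaloisRestrict k K ((absoluteGaloisGroup.toAlgEquiv K).symm τ) = 1 := by
      apply absGaloisRestrict_eq_one_of_forall_smul_eq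
      intro z hz
      rw [absoluteGaloisGroup.toAlgEquiv_symm_apply]
      exact (IntermediateField.mem_fixingSubgroup_iff _ _).mp hτ z
        (hAL (mem_algebraicClosure_iff.mpr hz))
    have hτE₀ : τ ∈ E₀.fixingSubgroup := by
      rw [IntermediateField.mem_fixingSubgroup_iff] at hτ ⊢
      exact fun z hz => hτ z (hE₀L hz)
    have hτU : (⟨(absoluteGaloisGroup.toAlgEquiv K).symm τ, MonoidHom.mem_ker.mpr hτΔ⟩ :
        (absGaloisRestrict k K).toMonoidHom.ker) ∈ U := by
      rw [← SetLike.mem_coe, ← hVU]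
      exact hE₀V hτE₀
    have h2 : (absoluteGaloisGroup.toAlgEquiv K).symm τ * (σ : absoluteGaloisGroup K) =
        (σ : absoluteGaloisGroup K) * (absoluteGaloisGroup.toAlgEquiv K).symm τ :=
      congrArg Subtype.val (hσ _ hτU)
    have h3 := congrArg (fun g : absoluteGaloisGroup K => absoluteGaloisGroup.toAlgEquiv K g y) h2
    simpa [hσ', AlgEquiv.mul_apply] using h3
  -- KEY: for every `y ≠ 0`, `σ'(y)/y` is algebraic over `k`
  have key : ∀ y : AlgebraicClosure K, y ≠ 0 → IsAlgebraic k (σ' y / y) := by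
    intro y hy0
    haveI : FiniteDimensional K K⟮y⟯ :=
      IntermediateField.adjoin.finiteDimensional (Algebra.IsIntegral.isIntegral y)
    set M : IntermediateField K (AlgebraicClosure K) := E₀ ⊔ K⟮y⟯ with hMdef
    haveI : FiniteDimensional K M := IntermediateField.finiteDimensional_sup E₀ K⟮y⟯
    have hyM : y ∈ M := (le_sup_right : K⟮y⟯ ≤ M) (IntermediateField.mem_adjoin_simple_self K y)
    -- `L = M · k̃`
    set L : IntermediateField K (AlgebraicClosure K) := IntermediateField.adjoin K
      ((M : Set (AlgebraicClosure K)) ∪ (algebraicClosure k (AlgebraicClosure K) : Set _))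
      with hLdef
    have hML : M ≤ L := fun z hz => IntermediateField.subset_adjoin K _ (Or.inl hz)
    have hAL : ((algebraicClosure k (AlgebraicClosure K) : Set (AlgebraicClosure K)) ⊆ L) :=
      fun z hz => IntermediateField.subset_adjoin K _ (Or.inr hz)
    have hE₀L : E₀ ≤ L := (le_sup_left : E₀ ≤ M).trans hML
    have hcommL := hcomm L hE₀L hAL
    -- (1) Kummer: `σ'(y)/y` is an `n`-th power in `L` for every `n ≥ 1`
    have hKum : ∀ n : ℕ, 0 < n → ∃ β ∈ L, β ^ n = σ' y / y := by
      intro n hn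
      obtain ⟨α, hα⟩ := IsAlgClosed.exists_pow_nat_eq y hn
      have hα0 : α ≠ 0 := by
        rintro rfl
        rw [zero_pow hn.ne'] at hα
        exact hy0 hα.symm
      refine ⟨σ' α / α, ?_, by rw [div_pow, ← map_pow, hα]⟩
      rw [← InfiniteGalois.fixedField_fixingSubgroup L, IntermediateField.mem_fixedField_iff]
      intro τ hτ
      have hτy : τ y = y := (IntermediateField.mem_fixingSubgroup_iff _ _).mp hτ y (hML hyM)
      have hζn : (τ α / α) ^ n = 1 := by
        rw [div_pow, ← map_pow, hα, hτy, div_self hy0]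
      have hζ0 : τ α / α ≠ 0 := div_ne_zero ((map_ne_zero τ).mpr hα0) hα0
      have hζalg : IsAlgebraic k (τ α / α) := by
        have hint : IsIntegral k ((τ α / α) ^ n) := by
          rw [hζn]
          exact isIntegral_one
        exact (IsIntegral.of_pow hn hint).isAlgebraic
      have hσζ : σ' (τ α / α) = τ α / α := hσalg _ hζalg
      have hτα : τ α = (τ α / α) * α := by rw [div_mul_cancel₀ _ hα0]
      have hτα0 : τ α ≠ 0 := (map_ne_zero τ).mpr hα0
      rw [map_div₀, hcommL τ hτ α, hτα, map_mul, hσζ]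
      field_simp
    -- the element `c = σ'(y)/y` and a finite extension `M' ⊇ M` of `K` inside `L` containing it
    have hc0 : σ' y / y ≠ 0 := div_ne_zero ((map_ne_zero σ').mpr hy0) hy0
    obtain ⟨β₁, hcL, hβ₁⟩ := hKum 1 one_pos
    rw [pow_one] at hβ₁
    rw [hβ₁] at hcL
    obtain ⟨T, hTsub, hcT⟩ := IntermediateField.exists_finset_of_mem_adjoin hcL
    haveI : FiniteDimensional K (IntermediateField.adjoin K (T : Set (AlgebraicClosure K))) :=
      IntermediateField.finiteDimensional_adjoin fun z _ => Algebra.IsIntegral.isIntegral z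
    set M' : IntermediateField K (AlgebraicClosure K) :=
      M ⊔ IntermediateField.adjoin K (T : Set (AlgebraicClosure K)) with hM'def
    haveI : FiniteDimensional K M' := IntermediateField.finiteDimensional_sup _ _
    have hcM' : σ' y / y ∈ M' :=
      (le_sup_right : IntermediateField.adjoin K (T : Set (AlgebraicClosure K)) ≤ M') hcT
    have hMM' : M ≤ M' := le_sup_left
    have hTL : (T : Set (AlgebraicClosure K)) ⊆ L :=
      hTsub.trans (Set.union_subset (fun z hz => hML hz) hAL)
    -- `M'` is an algebraic function field of one variable over `k`
    haveI : IsAlgFunctionField k M' :=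
      isAlgFunctionField_of_finiteDimensional (K := k) (F := K) (F' := M')
    haveI : IsScalarTower k M' (AlgebraicClosure K) := IsScalarTower.of_algebraMap_eq fun _ => rfl
    -- (2) apply the divisibility lemma to `c ∈ M'`
    have halg : IsAlgebraic k (⟨σ' y / y, hcM'⟩ : M') := by
      refine isAlgebraic_of_forall_exists_pow_eq (k := k) (F := M') (Ω := AlgebraicClosure K)
        (fun h0 => hc0 (congrArg Subtype.val h0)) fun n hn => ?_
      obtain ⟨β, hβL, hβn⟩ := hKum n hn
      obtain ⟨Tn, hTnsub, hβTn⟩ := IntermediateField.exists_finset_of_mem_adjoin hβL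
      set S : Finset (AlgebraicClosure K) :=
        Tn.filter fun z => z ∈ algebraicClosure k (AlgebraicClosure K) with hSdef
      haveI : FiniteDimensional k (IntermediateField.adjoin k (S : Set (AlgebraicClosure K))) :=
        IntermediateField.finiteDimensional_adjoin fun z hz => by
          have hz' := (Finset.mem_filter.mp (Finset.mem_coe.mp hz)).2
          exact mem_algebraicClosure_iff'.mp hz'
      refine ⟨IntermediateField.adjoin k (S : Set (AlgebraicClosure K)), inferInstance, β, ?_, hβn⟩
      have hle : IntermediateField.adjoin K (Tn : Set (AlgebraicClosure K)) ≤
          (IntermediateField.adjoin M' ((IntermediateField.adjoin k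
            (S : Set (AlgebraicClosure K)) : IntermediateField k (AlgebraicClosure K)) :
              Set (AlgebraicClosure K))).restrictScalars K := by
        rw [IntermediateField.adjoin_le_iff]
        intro z hz
        rw [IntermediateField.coe_restrictScalars, SetLike.mem_coe]
        rcases hTnsub hz with hzM | hzA
        · exact (IntermediateField.adjoin M' _).algebraMap_mem ⟨z, hMM' hzM⟩
        · apply IntermediateField.subset_adjoin
          apply IntermediateField.subset_adjoin
          exact Finset.mem_coe.mpr (Finset.mem_filter.mpr ⟨hz, hzA⟩)
      exact hle hβTn
    have := halg.algebraMap (A := AlgebraicClosure K)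
    exact this
  -- (3) conclusion: `σ' x = x`
  intro x
  by_cases hx0 : x = 0
  · rw [hx0, map_zero]
  by_cases hxalg : IsAlgebraic k x
  · exact hσalg x hxalg
  have hx1 : 1 + x ≠ 0 := by
    intro h
    apply hxalg
    have hx : x = algebraMap k (AlgebraicClosure K) (-1) := by
      rw [map_neg, map_one]
      linear_combination h
    rw [hx]
    exact isAlgebraic_algebraMap _
  have hc₁ := key x hx0
  have hc₂ := key (1 + x) hx1
  have h1 : σ' x = σ' x / x * x := by rw [div_mul_cancel₀ _ hx0]
  have h2 : σ' (1 + x) = σ' (1 + x) / (1 + x) * (1 + x) := by rw [div_mul_cancel₀ _ hx1]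
  have h3 : σ' (1 + x) = 1 + σ' x := by rw [map_add, map_one]
  have h4 : σ' (1 + x) / (1 + x) - 1 = (σ' x / x - σ' (1 + x) / (1 + x)) * x := by
    have e : σ' (1 + x) / (1 + x) * (1 + x) = 1 + σ' x / x * x := by rw [← h2, h3, ← h1]
    linear_combination e
  by_cases hc : σ' x / x = σ' (1 + x) / (1 + x)
  · rw [hc, sub_self, zero_mul, sub_eq_zero] at h4
    rw [h1, hc, h4, one_mul]
  · exfalso
    apply hxalg
    have hxeq : x = (σ' (1 + x) / (1 + x) - 1) / (σ' x / x - σ' (1 + x) / (1 + x)) := by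
      rw [h4, mul_div_cancel_left₀ _ (sub_ne_zero.mpr hc)]
    rw [hxeq, ← mem_algebraicClosure_iff]
    have hm₁ : σ' x / x ∈ algebraicClosure k (AlgebraicClosure K) := mem_algebraicClosure_iff.mpr hc₁
    have hm₂ : σ' (1 + x) / (1 + x) ∈ algebraicClosure k (AlgebraicClosure K) :=
      mem_algebraicClosure_iff.mpr hc₂
    exact div_mem (sub_mem hm₂ (one_mem _)) (sub_mem hm₁ hm₂)

/-- **[AbsTopIII] Theorem 1.11, slimness of `Δ_{η_X}` (second conjunct of `Thm_1_11_slim`) — for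
every base field `k` of characteristic zero.**  For an algebraic function field of one variable
`K/k` (`char k = 0`) with `Gal(K̄/K) → Gal(k̄/k)` surjective, the kernel
`Δ_{η_X} = (genericPointExtension k K hsurj).geom` is slim.  (Kummer-faithfulness of `k` and `k`
algebraically closed in `K` are not needed.) [cite: MochizukiAbsTopIII2015, Thm 1.11 pp.45–47] -/
theorem isSlimGroup_geom_genericPointExtension (k K : Type u) [Field k] [CharZero k] [Field K]
    [CharZero K] [Algebra k K] [IsAlgFunctionField k K]
    (hsurj : Function.Surjective (absGaloisRestrict k K)) :
    IsSlimGroup (genericPointExtension k K hsurj).geom :=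
  isSlimGroup_ker_absGaloisRestrict k K

/-- **Reduction of the fact `Thm_1_11_slim`** to its conjuncts (a) (`Π_{η_X} = Gal(K̄/K)` slim over
Kummer-faithful `k`) and (c) ("Kummer-faithful ⟹ `G_k` slim"), the conjunct (b) (`Δ_{η_X}` slim)
being `isSlimGroup_geom_genericPointExtension`. [cite: MochizukiAbsTopIII2015, Thm 1.11 pp.45–47] -/
theorem Thm_1_11_slim_of_generic_of_base
    (ha : ∀ (k K : Type u) [Field k] [Field K] [Algebra k K] [IsAlgFunctionField k K],
      IsKummerFaithful k → IsSlimGroup (Field.absoluteGaloisGroup K))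
    (hc : ∀ (k : Type u) [Field k], IsKummerFaithful k → IsSlimGroup (Field.absoluteGaloisGroup k)) :
    Thm_1_11_slim.{u} := by
  intro k K _ _ _ _ _ _ _ hsurj hk
  exact ⟨ha k K hk, isSlimGroup_geom_genericPointExtension k K hsurj, hc k hk⟩

end Literature.AnabelianGeometry.AbsoluteAnabelian.AbsTopIII
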